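import Mathlib

/-!
# Affine and quadratic matrix pencils on a parameter segment: semidefiniteness from endpoint / control-point
# data, and the scalar Bernstein and curvature-charged editions an `ℓ¹`-priced certificate reader meets

Topic `Literature/Computation/Certificates`; companion of `CovarianceBoxCertificate.lean` (weak duality over a
parameter cell for θ-AFFINE program data; floors F0/F1 of the exact reader `boxdual.reader`) and of
`TensorBernsteinEnclosure.lean` (range enclosure by Bernstein coefficients, general degree). Written for the Hubbard
algorithmic cell (hubbard-algo-p2, item «region-valid dual on a t′-segment», deliverable D1): «a dual slack / a
program datum is certified at the two ENDPOINTS of a parameter segment — what holds in the INTERIOR?» for data AFFINE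
in the parameter (everything, by convexity) and for data QUADRATIC in the parameter (nothing by itself; three
sufficient certificates are typed, and the scalar editions say which one fixed-multiplier replays can meet).
Everything is PROVED over `ℝ`; no definition, no named fact, no number.

§1 AFFINE PENCILS (convexity of the PSD cone, [cite: BoydVandenberghe2004, §2.2.5]): `posSemidef_convexComb`
(`A₀, A₁ ⪰ 0`, `s ∈ [0,1]` ⇒ `(1-s)•A₀ + s•A₁ ⪰ 0`; Mathlib's `Matrix.PosSemidef.smul` + `.add` under a name),
`posSemidef_affinePencil_of_endpoints` (`B₀ ⪰ 0`, `B₀ + B₁ ⪰ 0` ⇒ `B₀ + s•B₁ ⪰ 0` on `[0,1]`),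
`posSemidef_affinePencil_Icc` (general segment `t ∈ [a,b]` from the two endpoint matrices). These are the ONE-parameter
(`K = 1`, box = a segment) instances of the vertex theorem for LINEAR PARAMETRIC interval matrices already in the
tree, `Literature.Analysis.ValidatedNumerics.ParametricIntervalPosSemidef.posSemidef_of_forall_vertex`
([cite: Hladik2017, Thm. 3]: the `2^K` parameter vertices decide semidefiniteness of `Σ_k p_k • A^{(k)}` on a box),
kept here in the un-indexed pencil form `B₀ + s•B₁` that the quadratic identities of §2 rewrite into; for `K ≥ 2`
parameters (a `(U, t′)` box with affine data) cite that theorem, not this file.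

§2 QUADRATIC PENCILS `Q(s) = B₀ + s•B₁ + s²•B₂`. Endpoint semidefiniteness does NOT propagate (`n = 1`,
`Q(s) = (1-2s)² - ε`, `0 < ε ≤ 1`: `≥ 0` at `s = 0, 1`, `< 0` at `s = ½`); three sufficient certificates, each an
exact identity plus §1: (Q1) `quadPencil_eq_chord_sub` (`Q(s) = (1-s)•Q(0) + s•Q(1) - (s(1-s))•B₂`) and
`posSemidef_quadPencil_of_endpoints_of_curv` (`Q(0), Q(1), -B₂ ⪰ 0` ⇒ `Q ⪰ 0` on `[0,1]`: the chord of a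
Loewner-concave pencil is a minorant); (Q2) `posSemidef_quadPencil_of_margins` (`Q(0) ⪰ m₀1`, `Q(1) ⪰ m₁1`,
`B₂ ⪯ M1`, `0 ≤ M`, `M/4 ≤ m₀, m₁` ⇒ `Q ⪰ 0`: endpoint MARGINS pay the curvature, `s(1-s) ≤ ¼`);
(Q3) `quadPencil_eq_bernstein` (`Q(s) = (1-s)²•Q(0) + 2s(1-s)•C + s²•Q(1)`, middle CONTROL matrix
`C = B₀ + ½•B₁ = 2•Q(½) - ½•Q(0) - ½•Q(1)`, `bernsteinControl_eq_three_point`; de Casteljau / Bézier form,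
[cite: CargoShisha1966, Thm 1]) and `posSemidef_quadPencil_of_bernsteinControls` (`Q(0), C, Q(1) ⪰ 0` ⇒ `Q ⪰ 0`).
On a general segment `[a,b]`, for `P(t) = C₀ + t•C₁ + t²•C₂` the control matrix is the pencil EVALUATED AT THE
PSEUDO-VERTEX `((a+b)/2, ab)` of the lifted coordinates `(t, t²)`, `P̂ = C₀ + ((a+b)/2)•C₁ + (ab)•C₂ =
2•P((a+b)/2) - ½•P(a) - ½•P(b)` (`quadPencil_Icc_eq_bernstein`, `control_Icc_eq_three_point`,
`posSemidef_quadPencil_Icc_of_controls`). Geometric content used by parameter-box readers (§3): the parabola arc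
`{(t,t²) : t ∈ [a,b]}` lies in the TRIANGLE `(a,a²), ((a+b)/2, ab), (b,b²)` with the explicit Bernstein weights
`(1-σ)², 2σ(1-σ), σ²`, `σ = (t-a)/(b-a)` (`parabolaArc_bernstein`, `bernsteinWeights_nonneg_sum`):
program data QUADRATIC in `t` are AFFINE data on that lifted simplex, whose third vertex carries the exact rational
combination `2P(m) - ½P(a) - ½P(b)` of three GENERATED programs, so the affine-data kernel
`CovarianceBox.le_of_pairwiseBernstein` applies verbatim.

§3–§4 SCALAR EDITIONS — what a fixed-multiplier, `ℓ¹`-priced certificate formula meets: re-evaluated along the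
segment its value is `E(s) = β(s) - Σ_v ρ_v |r_v(s)|` with `β`, `r_v` polynomial in the parameter
([cite: Bertsekas1999NonlinearProgramming, Prop. 5.1.3] for the weak-duality reading, [cite: CargoShisha1966, Thm 1]
for the enclosure, [cite: AscherGreif2011, §10.5] — the polynomial interpolation error formula, exact in degree 2 —
for the chord identities): `abs_quadratic_le_chord_add_curv` (`|r(s)| ≤ (1-s)|r(0)| + s|r(1)| + s(1-s)|r₂|`),
`chord_sub_curv_le_quadratic`, `quadratic_eq_bernstein` / `min_controls_le_quadratic` / `abs_quadratic_le_bernstein`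
(degree-2 Bernstein enclosure; three-replay control value `c = 2r(½) - (r(0)+r(1))/2`,
`bernsteinControl_eq_three_point_real`), and the certificate FLOORS for a finite residual family:
`certValue_ge_chord_sub_curv` (`E(s) ≥ (1-s)E(0) + sE(1) - s(1-s)[max(β₂,0) + Σ_v ρ_v|r₂,v|]`),
`certValue_ge_min_endpoints_sub_quarter_curv` (`≥ min(E(0),E(1)) - ¼[…]`) and `certValue_ge_min_controls`
(`E(s) ≥ min(E(0), E_C, E(1))`, `E_C` = the bound formula on the CONTROL data). For AFFINE data (`β₂ = 0`, `r₂ = 0`)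
all reduce to `E(s) ≥ min(E(0), E(1))` — the concave case `L ≤ 0` of `CovarianceBox.segment_endpointFloor_le`.

NOT here: dual FEASIBILITY of conic programs (readers never test it: the PSD multiplier is fixed file data, the
residual is priced); the exact matrix Markov–Lukács characterisation of pencils nonnegative on a segment (an SDP, not
a closed form); higher degree (`TensorBernsteinEnclosure`); subdivision. Mathlib search: `Matrix.PosSemidef.add`,
`.smul`, `.one` (`Mathlib.LinearAlgebra.Matrix.PosDef`; `PosSemidef` is `Finsupp`-based, no `Fintype` needed); no
pencil / segment statement in Mathlib or the tree (`FluidPDE…posSemidef_convexDefect` and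
`FixedDualTransfer.posSemidef_shiftTransfer` — a first-order Weyl shift — are the nearest, neither used).
-/

namespace Literature.Computation.Certificates.PencilSegment

open Matrix

/-! ## §1 Affine pencils: convexity of the PSD cone -/

section Affine

variable {n : Type*}

/-- **Convexity of the PSD cone.** `A₀ ⪰ 0`, `A₁ ⪰ 0`, `0 ≤ s ≤ 1` ⇒ `(1-s)•A₀ + s•A₁ ⪰ 0`.
[cite: BoydVandenberghe2004, §2.2.5] -/
theorem posSemidef_convexComb {A₀ A₁ : Matrix n n ℝ} (h₀ : A₀.PosSemidef) (h₁ : A₁.PosSemidef)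
    {s : ℝ} (hs0 : 0 ≤ s) (hs1 : s ≤ 1) : ((1 - s) • A₀ + s • A₁).PosSemidef :=
  (h₀.smul (sub_nonneg.mpr hs1)).add (h₁.smul hs0)

/-- **Affine pencil on `[0,1]` from its endpoints.** `B₀ ⪰ 0` and `B₀ + B₁ ⪰ 0` ⇒ `B₀ + s•B₁ ⪰ 0` for
`s ∈ [0,1]` (`B₀ + s•B₁ = (1-s)•B₀ + s•(B₀+B₁)`). [cite: BoydVandenberghe2004, §2.2.5] -/
theorem posSemidef_affinePencil_of_endpoints {B₀ B₁ : Matrix n n ℝ} (h0 : B₀.PosSemidef)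
    (h1 : (B₀ + B₁).PosSemidef) {s : ℝ} (hs0 : 0 ≤ s) (hs1 : s ≤ 1) :
    (B₀ + s • B₁).PosSemidef := by
  have key : B₀ + s • B₁ = (1 - s) • B₀ + s • (B₀ + B₁) := by
    ext i j; simp [Matrix.add_apply, Matrix.smul_apply]; ring
  rw [key]
  exact posSemidef_convexComb h0 h1 hs0 hs1

/-- **Affine pencil on a general segment.** If `B₀ + a•B₁ ⪰ 0` and `B₀ + b•B₁ ⪰ 0` then `B₀ + t•B₁ ⪰ 0` for
every `t ∈ [a,b]` (barycentric reparametrisation `σ = (t-a)/(b-a)`). [cite: BoydVandenberghe2004, §2.2.5] -/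
theorem posSemidef_affinePencil_Icc {B₀ B₁ : Matrix n n ℝ} {a b : ℝ} (ha : (B₀ + a • B₁).PosSemidef)
    (hb : (B₀ + b • B₁).PosSemidef) {t : ℝ} (ht : t ∈ Set.Icc a b) : (B₀ + t • B₁).PosSemidef := by
  rcases eq_or_lt_of_le (ht.1.trans ht.2) with hab | hab
  · -- degenerate segment: t = a
    have : t = a := le_antisymm (hab ▸ ht.2) ht.1
    simpa [this] using ha
  · have hba : 0 < b - a := sub_pos.mpr hab
    set σ := (t - a) / (b - a) with hσ
    have hσ0 : 0 ≤ σ := div_nonneg (sub_nonneg.mpr ht.1) hba.le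
    have hσ1 : σ ≤ 1 := (div_le_one hba).mpr (sub_le_sub_right ht.2 a)
    have key : B₀ + t • B₁ = (1 - σ) • (B₀ + a • B₁) + σ • (B₀ + b • B₁) := by
      ext i j
      simp only [Matrix.add_apply, Matrix.smul_apply, smul_eq_mul, hσ]
      field_simp
      ring
    rw [key]
    exact posSemidef_convexComb ha hb hσ0 hσ1

end Affine

/-! ## §2 Quadratic pencils `Q(s) = B₀ + s•B₁ + s²•B₂` -/

section Quadratic

variable {n : Type*}

/-- Chord identity of a quadratic pencil: `Q(s) = (1-s)•Q(0) + s•Q(1) - (s(1-s))•B₂` — the linear-interpolation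
error formula, exact for quadratics (entrywise; nodes `0, 1`, `f''/2 = B₂`). [cite: AscherGreif2011, §10.5] -/
theorem quadPencil_eq_chord_sub (B₀ B₁ B₂ : Matrix n n ℝ) (s : ℝ) :
    B₀ + s • B₁ + s ^ 2 • B₂ = (1 - s) • B₀ + s • (B₀ + B₁ + B₂) - (s * (1 - s)) • B₂ := by
  ext i j; simp [Matrix.add_apply, Matrix.sub_apply, Matrix.smul_apply]; ring

/-- **Concave quadratic pencil** (certificate Q1): `Q(0) ⪰ 0`, `Q(1) ⪰ 0` and `-B₂ ⪰ 0` ⇒ `Q(s) ⪰ 0` on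
`[0,1]` — the chord of a Loewner-concave pencil is a minorant. [cite: BoydVandenberghe2004, §2.2.5] -/
theorem posSemidef_quadPencil_of_endpoints_of_curv {B₀ B₁ B₂ : Matrix n n ℝ} (h0 : B₀.PosSemidef)
    (h1 : (B₀ + B₁ + B₂).PosSemidef) (h2 : (-B₂).PosSemidef) {s : ℝ} (hs0 : 0 ≤ s) (hs1 : s ≤ 1) :
    (B₀ + s • B₁ + s ^ 2 • B₂).PosSemidef := by
  have key : B₀ + s • B₁ + s ^ 2 • B₂ =
      ((1 - s) • B₀ + s • (B₀ + B₁ + B₂)) + (s * (1 - s)) • (-B₂) := by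
    ext i j; simp [Matrix.add_apply, Matrix.smul_apply, Matrix.neg_apply]; ring
  rw [key]
  exact (posSemidef_convexComb h0 h1 hs0 hs1).add (h2.smul (mul_nonneg hs0 (sub_nonneg.mpr hs1)))

/-- **Endpoint margins pay the curvature** (certificate Q2): `Q(0) - m₀·1 ⪰ 0`, `Q(1) - m₁·1 ⪰ 0`,
`M·1 - B₂ ⪰ 0`, `0 ≤ M`, `M/4 ≤ m₀`, `M/4 ≤ m₁` ⇒ `Q(s) ⪰ 0` on `[0,1]`
(`Q(s) = (1-s)•(Q(0)-m₀1) + s•(Q(1)-m₁1) + s(1-s)•(M1-B₂) + [(1-s)m₀ + s m₁ - s(1-s)M]•1` and the bracket is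
`≥ M(¼ - s(1-s)) ≥ 0`). [cite: BoydVandenberghe2004, §2.2.5] -/
theorem posSemidef_quadPencil_of_margins [DecidableEq n] {B₀ B₁ B₂ : Matrix n n ℝ} {m₀ m₁ M : ℝ}
    (h0 : (B₀ - m₀ • (1 : Matrix n n ℝ)).PosSemidef)
    (h1 : (B₀ + B₁ + B₂ - m₁ • (1 : Matrix n n ℝ)).PosSemidef)
    (h2 : (M • (1 : Matrix n n ℝ) - B₂).PosSemidef) (hM : 0 ≤ M) (hm₀ : M / 4 ≤ m₀) (hm₁ : M / 4 ≤ m₁)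
    {s : ℝ} (hs0 : 0 ≤ s) (hs1 : s ≤ 1) : (B₀ + s • B₁ + s ^ 2 • B₂).PosSemidef := by
  have h1s : 0 ≤ 1 - s := sub_nonneg.mpr hs1
  set c : ℝ := (1 - s) * m₀ + s * m₁ - s * (1 - s) * M with hc
  have hc0 : 0 ≤ c := by
    have hss : s * (1 - s) ≤ 1 / 4 := by nlinarith [sq_nonneg (s - 1 / 2)]
    have : (1 - s) * (M / 4) + s * (M / 4) - s * (1 - s) * M ≤ c := by
      rw [hc]; nlinarith [mul_le_mul_of_nonneg_left hm₀ h1s, mul_le_mul_of_nonneg_left hm₁ hs0]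
    nlinarith [mul_le_mul_of_nonneg_left hss hM]
  have key : B₀ + s • B₁ + s ^ 2 • B₂ =
      ((1 - s) • (B₀ - m₀ • (1 : Matrix n n ℝ)) + s • (B₀ + B₁ + B₂ - m₁ • (1 : Matrix n n ℝ)))
        + (s * (1 - s)) • (M • (1 : Matrix n n ℝ) - B₂) + c • (1 : Matrix n n ℝ) := by
    ext i j
    simp only [Matrix.add_apply, Matrix.sub_apply, Matrix.smul_apply, Matrix.one_apply, smul_eq_mul, hc]
    split_ifs <;> ring
  rw [key]
  exact ((posSemidef_convexComb h0 h1 hs0 hs1).add (h2.smul (mul_nonneg hs0 h1s))).add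
    (Matrix.PosSemidef.one.smul hc0)

/-- **Bernstein (de Casteljau) form of a quadratic pencil on `[0,1]`**:
`Q(s) = (1-s)²•Q(0) + 2s(1-s)•C + s²•Q(1)` with the middle control matrix `C = B₀ + ½•B₁`.
[cite: CargoShisha1966, Thm 1] -/
theorem quadPencil_eq_bernstein (B₀ B₁ B₂ : Matrix n n ℝ) (s : ℝ) :
    B₀ + s • B₁ + s ^ 2 • B₂ =
      (1 - s) ^ 2 • B₀ + (2 * s * (1 - s)) • (B₀ + (1 / 2 : ℝ) • B₁) + s ^ 2 • (B₀ + B₁ + B₂) := by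
  ext i j; simp [Matrix.add_apply, Matrix.smul_apply]; ring

/-- **The control matrix from three evaluations**: `B₀ + ½•B₁ = 2•Q(½) - ½•Q(0) - ½•Q(1)` — a reader holding the
pencil at the two endpoints and the midpoint recovers the middle Bézier control matrix exactly. [cite: CargoShisha1966, Thm 1] -/
theorem bernsteinControl_eq_three_point (B₀ B₁ B₂ : Matrix n n ℝ) :
    B₀ + (1 / 2 : ℝ) • B₁ =
      (2 : ℝ) • (B₀ + (1 / 2 : ℝ) • B₁ + (1 / 2 : ℝ) ^ 2 • B₂) - (1 / 2 : ℝ) • B₀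
        - (1 / 2 : ℝ) • (B₀ + B₁ + B₂) := by
  ext i j; simp [Matrix.add_apply, Matrix.sub_apply, Matrix.smul_apply]; ring

/-- **Control-point certificate** (Q3): `Q(0) ⪰ 0`, `B₀ + ½•B₁ ⪰ 0` (the middle control matrix) and `Q(1) ⪰ 0`
⇒ `Q(s) ⪰ 0` on `[0,1]` (Bernstein weights are nonnegative). Neither this hypothesis nor Q1's `-B₂ ⪰ 0` implies the
other. [cite: CargoShisha1966, Thm 1] -/
theorem posSemidef_quadPencil_of_bernsteinControls {B₀ B₁ B₂ : Matrix n n ℝ} (h0 : B₀.PosSemidef)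
    (hC : (B₀ + (1 / 2 : ℝ) • B₁).PosSemidef) (h1 : (B₀ + B₁ + B₂).PosSemidef) {s : ℝ} (hs0 : 0 ≤ s)
    (hs1 : s ≤ 1) : (B₀ + s • B₁ + s ^ 2 • B₂).PosSemidef := by
  rw [quadPencil_eq_bernstein]
  have h1s : 0 ≤ 1 - s := sub_nonneg.mpr hs1
  exact ((h0.smul (sq_nonneg (1 - s))).add (hC.smul (by positivity))).add (h1.smul (sq_nonneg s))

/-- **Bernstein form on a general segment.** For `P(t) = C₀ + t•C₁ + t²•C₂` and `a ≠ b`, with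
`σ = (t-a)/(b-a)`: `P(t) = (1-σ)²•P(a) + 2σ(1-σ)•P̂ + σ²•P(b)` where the control matrix is the pencil evaluated at
the PSEUDO-VERTEX `((a+b)/2, ab)` of the lifted coordinates `(t, t²)`: `P̂ = C₀ + ((a+b)/2)•C₁ + (ab)•C₂`.
[cite: CargoShisha1966, Thm 1] -/
theorem quadPencil_Icc_eq_bernstein (C₀ C₁ C₂ : Matrix n n ℝ) {a b : ℝ} (hab : a ≠ b) (t : ℝ) :
    C₀ + t • C₁ + t ^ 2 • C₂ =
      (1 - (t - a) / (b - a)) ^ 2 • (C₀ + a • C₁ + a ^ 2 • C₂)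
        + (2 * ((t - a) / (b - a)) * (1 - (t - a) / (b - a))) • (C₀ + ((a + b) / 2) • C₁ + (a * b) • C₂)
        + ((t - a) / (b - a)) ^ 2 • (C₀ + b • C₁ + b ^ 2 • C₂) := by
  have hba : b - a ≠ 0 := sub_ne_zero.mpr (Ne.symm hab)
  ext i j
  simp only [Matrix.add_apply, Matrix.smul_apply, smul_eq_mul]
  field_simp
  ring

/-- **The pseudo-vertex control matrix from three generated pencil values**:
`C₀ + ((a+b)/2)•C₁ + (ab)•C₂ = 2•P((a+b)/2) - ½•P(a) - ½•P(b)`. [cite: CargoShisha1966, Thm 1] -/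
theorem control_Icc_eq_three_point (C₀ C₁ C₂ : Matrix n n ℝ) (a b : ℝ) :
    C₀ + ((a + b) / 2) • C₁ + (a * b) • C₂ =
      (2 : ℝ) • (C₀ + ((a + b) / 2) • C₁ + ((a + b) / 2) ^ 2 • C₂)
        - (1 / 2 : ℝ) • (C₀ + a • C₁ + a ^ 2 • C₂) - (1 / 2 : ℝ) • (C₀ + b • C₁ + b ^ 2 • C₂) := by
  ext i j; simp [Matrix.add_apply, Matrix.sub_apply, Matrix.smul_apply]; ring

/-- **Control-point certificate on a general segment**: `P(a) ⪰ 0`, `P(b) ⪰ 0` and the pseudo-vertex control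
matrix `C₀ + ((a+b)/2)•C₁ + (ab)•C₂ ⪰ 0` ⇒ `P(t) ⪰ 0` for every `t ∈ [a,b]`. [cite: CargoShisha1966, Thm 1] -/
theorem posSemidef_quadPencil_Icc_of_controls {C₀ C₁ C₂ : Matrix n n ℝ} {a b : ℝ}
    (ha : (C₀ + a • C₁ + a ^ 2 • C₂).PosSemidef) (hb : (C₀ + b • C₁ + b ^ 2 • C₂).PosSemidef)
    (hm : (C₀ + ((a + b) / 2) • C₁ + (a * b) • C₂).PosSemidef) {t : ℝ} (ht : t ∈ Set.Icc a b) :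
    (C₀ + t • C₁ + t ^ 2 • C₂).PosSemidef := by
  rcases eq_or_lt_of_le (ht.1.trans ht.2) with hab | hab
  · have : t = a := le_antisymm (hab ▸ ht.2) ht.1
    simpa [this] using ha
  · have hba : 0 < b - a := sub_pos.mpr hab
    have hσ0 : 0 ≤ (t - a) / (b - a) := div_nonneg (sub_nonneg.mpr ht.1) hba.le
    have hσ1 : (t - a) / (b - a) ≤ 1 := (div_le_one hba).mpr (sub_le_sub_right ht.2 a)
    rw [quadPencil_Icc_eq_bernstein C₀ C₁ C₂ hab.ne t]
    have h1σ : 0 ≤ 1 - (t - a) / (b - a) := sub_nonneg.mpr hσ1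
    exact ((ha.smul (sq_nonneg _)).add (hm.smul (by positivity))).add (hb.smul (sq_nonneg _))

end Quadratic

/-! ## §3 The lifted parabola arc and the scalar editions a certificate reader meets -/

section Scalar

/-- **The parabola arc lies in the tangent–chord triangle** with explicit Bernstein weights: for `a ≠ b` and
`σ = (t-a)/(b-a)`, `(t, t²) = (1-σ)²·(a,a²) + 2σ(1-σ)·((a+b)/2, ab) + σ²·(b,b²)` (both coordinates).
[cite: CargoShisha1966, Thm 1] -/
theorem parabolaArc_bernstein {a b : ℝ} (hab : a ≠ b) (t : ℝ) :
    t = (1 - (t - a) / (b - a)) ^ 2 * a + 2 * ((t - a) / (b - a)) * (1 - (t - a) / (b - a)) * ((a + b) / 2)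
          + ((t - a) / (b - a)) ^ 2 * b ∧
    t ^ 2 = (1 - (t - a) / (b - a)) ^ 2 * a ^ 2
          + 2 * ((t - a) / (b - a)) * (1 - (t - a) / (b - a)) * (a * b) + ((t - a) / (b - a)) ^ 2 * b ^ 2 := by
  have hba : b - a ≠ 0 := sub_ne_zero.mpr (Ne.symm hab)
  constructor <;> field_simp <;> ring

/-- The degree-2 Bernstein weights are nonnegative on `[0,1]` and sum to one (so the arc point is a convex
combination of the three triangle vertices). [cite: CargoShisha1966, Thm 1] -/
theorem bernsteinWeights_nonneg_sum {σ : ℝ} (h0 : 0 ≤ σ) (h1 : σ ≤ 1) :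
    0 ≤ (1 - σ) ^ 2 ∧ 0 ≤ 2 * σ * (1 - σ) ∧ 0 ≤ σ ^ 2 ∧ (1 - σ) ^ 2 + 2 * σ * (1 - σ) + σ ^ 2 = 1 :=
  ⟨sq_nonneg _, by have := sub_nonneg.mpr h1; positivity, sq_nonneg _, by ring⟩

/-- Chord identity of a real quadratic: `r₀ + s r₁ + s² r₂ = (1-s) r(0) + s r(1) - s(1-s) r₂` (linear-interpolation
error formula at nodes `0, 1`, exact for a quadratic: `f - p₁ = (f''/2)·s(s-1)`). [cite: AscherGreif2011, §10.5] -/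
theorem quadratic_eq_chord_sub (r₀ r₁ r₂ s : ℝ) :
    r₀ + s * r₁ + s ^ 2 * r₂ = (1 - s) * r₀ + s * (r₀ + r₁ + r₂) - s * (1 - s) * r₂ := by ring

/-- **Curvature-charged chord bound for a priced residual**: on `[0,1]`,
`|r₀ + s r₁ + s² r₂| ≤ (1-s)|r(0)| + s|r(1)| + s(1-s)|r₂|` (interpolation error bound, degree 1, exact second
derivative `2r₂`). [cite: AscherGreif2011, §10.5] -/
theorem abs_quadratic_le_chord_add_curv (r₀ r₁ r₂ : ℝ) {s : ℝ} (hs0 : 0 ≤ s) (hs1 : s ≤ 1) :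
    |r₀ + s * r₁ + s ^ 2 * r₂| ≤ (1 - s) * |r₀| + s * |r₀ + r₁ + r₂| + s * (1 - s) * |r₂| := by
  have h1s : 0 ≤ 1 - s := sub_nonneg.mpr hs1
  have hss : 0 ≤ s * (1 - s) := mul_nonneg hs0 h1s
  rw [quadratic_eq_chord_sub, abs_le]
  constructor
  · nlinarith [mul_le_mul_of_nonneg_left (neg_abs_le r₀) h1s,
      mul_le_mul_of_nonneg_left (neg_abs_le (r₀ + r₁ + r₂)) hs0,
      mul_le_mul_of_nonneg_left (le_abs_self r₂) hss]
  · nlinarith [mul_le_mul_of_nonneg_left (le_abs_self r₀) h1s,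
      mul_le_mul_of_nonneg_left (le_abs_self (r₀ + r₁ + r₂)) hs0,
      mul_le_mul_of_nonneg_left (neg_abs_le r₂) hss]

/-- **The chord minus the positive curvature is a minorant**: on `[0,1]`,
`(1-s)β(0) + sβ(1) - s(1-s)·max(β₂,0) ≤ β₀ + sβ₁ + s²β₂` (one-sided interpolation error bound).
[cite: AscherGreif2011, §10.5] -/
theorem chord_sub_curv_le_quadratic (β₀ β₁ β₂ : ℝ) {s : ℝ} (hs0 : 0 ≤ s) (hs1 : s ≤ 1) :
    (1 - s) * β₀ + s * (β₀ + β₁ + β₂) - s * (1 - s) * max β₂ 0 ≤ β₀ + s * β₁ + s ^ 2 * β₂ := by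
  have hss : 0 ≤ s * (1 - s) := mul_nonneg hs0 (sub_nonneg.mpr hs1)
  nlinarith [mul_le_mul_of_nonneg_left (le_max_left β₂ 0) hss, quadratic_eq_chord_sub β₀ β₁ β₂ s]

/-- Bernstein form of a real quadratic on `[0,1]`: `r(s) = (1-s)² r(0) + 2s(1-s)·(r₀ + r₁/2) + s² r(1)`.
[cite: CargoShisha1966, Thm 1] -/
theorem quadratic_eq_bernstein (r₀ r₁ r₂ s : ℝ) :
    r₀ + s * r₁ + s ^ 2 * r₂ =
      (1 - s) ^ 2 * r₀ + 2 * s * (1 - s) * (r₀ + r₁ / 2) + s ^ 2 * (r₀ + r₁ + r₂) := by ring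

/-- The middle Bernstein coefficient from three evaluations: `r₀ + r₁/2 = 2 r(½) - (r(0) + r(1))/2`.
[cite: CargoShisha1966, Thm 1] -/
theorem bernsteinControl_eq_three_point_real (r₀ r₁ r₂ : ℝ) :
    r₀ + r₁ / 2 = 2 * (r₀ + (1 / 2) * r₁ + (1 / 2) ^ 2 * r₂) - (r₀ + (r₀ + r₁ + r₂)) / 2 := by ring

/-- **Degree-2 Bernstein enclosure (lower)**: on `[0,1]` a real quadratic is at least the least of its three
Bernstein coefficients `r(0)`, `r₀ + r₁/2`, `r(1)`. [cite: CargoShisha1966, Thm 1] -/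
theorem min_controls_le_quadratic (r₀ r₁ r₂ : ℝ) {s : ℝ} (hs0 : 0 ≤ s) (hs1 : s ≤ 1) :
    min (min r₀ (r₀ + r₁ / 2)) (r₀ + r₁ + r₂) ≤ r₀ + s * r₁ + s ^ 2 * r₂ := by
  set m := min (min r₀ (r₀ + r₁ / 2)) (r₀ + r₁ + r₂) with hm
  have hm0 : m ≤ r₀ := (min_le_left _ _).trans (min_le_left _ _)
  have hm1 : m ≤ r₀ + r₁ / 2 := (min_le_left _ _).trans (min_le_right _ _)
  have hm2 : m ≤ r₀ + r₁ + r₂ := min_le_right _ _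
  have hw0 : 0 ≤ (1 - s) ^ 2 := sq_nonneg _
  have hw1 : 0 ≤ 2 * s * (1 - s) := by have := sub_nonneg.mpr hs1; positivity
  have hw2 : 0 ≤ s ^ 2 := sq_nonneg _
  have hsum : (1 - s) ^ 2 * m + 2 * s * (1 - s) * m + s ^ 2 * m = m := by ring
  rw [quadratic_eq_bernstein]
  nlinarith [mul_le_mul_of_nonneg_left hm0 hw0, mul_le_mul_of_nonneg_left hm1 hw1,
    mul_le_mul_of_nonneg_left hm2 hw2]

/-- **Degree-2 Bernstein enclosure (absolute value)**: on `[0,1]`,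
`|r(s)| ≤ (1-s)²|r(0)| + 2s(1-s)|r₀ + r₁/2| + s²|r(1)|`. [cite: CargoShisha1966, Thm 1] -/
theorem abs_quadratic_le_bernstein (r₀ r₁ r₂ : ℝ) {s : ℝ} (hs0 : 0 ≤ s) (hs1 : s ≤ 1) :
    |r₀ + s * r₁ + s ^ 2 * r₂| ≤
      (1 - s) ^ 2 * |r₀| + 2 * s * (1 - s) * |r₀ + r₁ / 2| + s ^ 2 * |r₀ + r₁ + r₂| := by
  have hw0 : 0 ≤ (1 - s) ^ 2 := sq_nonneg _
  have hw1 : 0 ≤ 2 * s * (1 - s) := by have := sub_nonneg.mpr hs1; positivity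
  have hw2 : 0 ≤ s ^ 2 := sq_nonneg _
  rw [quadratic_eq_bernstein, abs_le]
  constructor
  · nlinarith [mul_le_mul_of_nonneg_left (neg_abs_le r₀) hw0,
      mul_le_mul_of_nonneg_left (neg_abs_le (r₀ + r₁ / 2)) hw1,
      mul_le_mul_of_nonneg_left (neg_abs_le (r₀ + r₁ + r₂)) hw2]
  · nlinarith [mul_le_mul_of_nonneg_left (le_abs_self r₀) hw0,
      mul_le_mul_of_nonneg_left (le_abs_self (r₀ + r₁ / 2)) hw1,
      mul_le_mul_of_nonneg_left (le_abs_self (r₀ + r₁ + r₂)) hw2]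

end Scalar

/-! ## §4 Certificate floors on a segment for a FIXED dual and data quadratic in the parameter
`E(s) = β(s) - Σ_{v ∈ Vs} ρ_v |r_v(s)|`, `β(s) = β₀ + sβ₁ + s²β₂`, `r_v(s) = r₀,v + s r₁,v + s² r₂,v`, `ρ_v ≥ 0`
(a-priori bounds); floors computable from finitely many exact replays; affine data ⇒ `E(s) ≥ min(E(0), E(1))`. -/

section Floors

variable {V : Type*}

/-- **Curvature-charged chord floor**: `E(s) ≥ (1-s)E(0) + sE(1) - s(1-s)·[max(β₂,0) + Σ_v ρ_v |r₂,v|]` on `[0,1]`.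
[cite: Bertsekas1999NonlinearProgramming, Prop. 5.1.3] -/
theorem certValue_ge_chord_sub_curv (Vs : Finset V) (ρ : V → ℝ) (hρ : ∀ v ∈ Vs, 0 ≤ ρ v)
    (β₀ β₁ β₂ : ℝ) (r₀ r₁ r₂ : V → ℝ) {s : ℝ} (hs0 : 0 ≤ s) (hs1 : s ≤ 1) :
    (1 - s) * (β₀ - ∑ v ∈ Vs, ρ v * |r₀ v|)
        + s * ((β₀ + β₁ + β₂) - ∑ v ∈ Vs, ρ v * |r₀ v + r₁ v + r₂ v|)
        - s * (1 - s) * (max β₂ 0 + ∑ v ∈ Vs, ρ v * |r₂ v|)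
      ≤ (β₀ + s * β₁ + s ^ 2 * β₂) - ∑ v ∈ Vs, ρ v * |r₀ v + s * r₁ v + s ^ 2 * r₂ v| := by
  have hβ := chord_sub_curv_le_quadratic β₀ β₁ β₂ hs0 hs1
  have hsum : ∑ v ∈ Vs, ρ v * |r₀ v + s * r₁ v + s ^ 2 * r₂ v| ≤
      ∑ v ∈ Vs, ρ v * ((1 - s) * |r₀ v| + s * |r₀ v + r₁ v + r₂ v| + s * (1 - s) * |r₂ v|) :=
    Finset.sum_le_sum fun v hv =>
      mul_le_mul_of_nonneg_left (abs_quadratic_le_chord_add_curv (r₀ v) (r₁ v) (r₂ v) hs0 hs1) (hρ v hv)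
  have hsplit : ∑ v ∈ Vs, ρ v * ((1 - s) * |r₀ v| + s * |r₀ v + r₁ v + r₂ v| + s * (1 - s) * |r₂ v|) =
      (1 - s) * ∑ v ∈ Vs, ρ v * |r₀ v| + s * ∑ v ∈ Vs, ρ v * |r₀ v + r₁ v + r₂ v|
        + s * (1 - s) * ∑ v ∈ Vs, ρ v * |r₂ v| := by
    simp only [Finset.mul_sum, ← Finset.sum_add_distrib]
    refine Finset.sum_congr rfl fun v _ => by ring
  linarith

/-- **Corner-replay floor with a quarter curvature charge**: `E(s) ≥ min(E(0), E(1)) - ¼[max(β₂,0) + Σ_v ρ_v |r₂,v|]`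
on `[0,1]` (`s(1-s) ≤ ¼`). [cite: Bertsekas1999NonlinearProgramming, Prop. 5.1.3] -/
theorem certValue_ge_min_endpoints_sub_quarter_curv (Vs : Finset V) (ρ : V → ℝ) (hρ : ∀ v ∈ Vs, 0 ≤ ρ v)
    (β₀ β₁ β₂ : ℝ) (r₀ r₁ r₂ : V → ℝ) {s : ℝ} (hs0 : 0 ≤ s) (hs1 : s ≤ 1) :
    min (β₀ - ∑ v ∈ Vs, ρ v * |r₀ v|) ((β₀ + β₁ + β₂) - ∑ v ∈ Vs, ρ v * |r₀ v + r₁ v + r₂ v|)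
        - (1 / 4) * (max β₂ 0 + ∑ v ∈ Vs, ρ v * |r₂ v|)
      ≤ (β₀ + s * β₁ + s ^ 2 * β₂) - ∑ v ∈ Vs, ρ v * |r₀ v + s * r₁ v + s ^ 2 * r₂ v| := by
  have h := certValue_ge_chord_sub_curv Vs ρ hρ β₀ β₁ β₂ r₀ r₁ r₂ hs0 hs1
  set E0 := β₀ - ∑ v ∈ Vs, ρ v * |r₀ v|
  set E1 := (β₀ + β₁ + β₂) - ∑ v ∈ Vs, ρ v * |r₀ v + r₁ v + r₂ v|
  set K := max β₂ 0 + ∑ v ∈ Vs, ρ v * |r₂ v|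
  have hK : 0 ≤ K :=
    add_nonneg (le_max_right _ _) (Finset.sum_nonneg fun v hv => mul_nonneg (hρ v hv) (abs_nonneg _))
  have hss : s * (1 - s) ≤ 1 / 4 := by nlinarith [sq_nonneg (s - 1 / 2)]
  have hmin0 : min E0 E1 ≤ E0 := min_le_left _ _
  have hmin1 : min E0 E1 ≤ E1 := min_le_right _ _
  nlinarith [mul_le_mul_of_nonneg_left hmin0 (sub_nonneg.mpr hs1), mul_le_mul_of_nonneg_left hmin1 hs0,
    mul_le_mul_of_nonneg_right hss hK]

/-- **Bernstein (control-replay) floor**: with the CONTROL value `E_C = (β₀ + β₁/2) - Σ_v ρ_v |r₀,v + r₁,v/2|`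
(the bound formula evaluated on the middle Bernstein coefficients of the data = on the exact combination
`2·data(½) - ½·data(0) - ½·data(1)` of three replays), `E(s) ≥ min(E(0), E_C, E(1))` on `[0,1]`.
[cite: Bertsekas1999NonlinearProgramming, Prop. 5.1.3] -/
theorem certValue_ge_min_controls (Vs : Finset V) (ρ : V → ℝ) (hρ : ∀ v ∈ Vs, 0 ≤ ρ v)
    (β₀ β₁ β₂ : ℝ) (r₀ r₁ r₂ : V → ℝ) {s : ℝ} (hs0 : 0 ≤ s) (hs1 : s ≤ 1) :
    min (min (β₀ - ∑ v ∈ Vs, ρ v * |r₀ v|) ((β₀ + β₁ / 2) - ∑ v ∈ Vs, ρ v * |r₀ v + r₁ v / 2|))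
        ((β₀ + β₁ + β₂) - ∑ v ∈ Vs, ρ v * |r₀ v + r₁ v + r₂ v|)
      ≤ (β₀ + s * β₁ + s ^ 2 * β₂) - ∑ v ∈ Vs, ρ v * |r₀ v + s * r₁ v + s ^ 2 * r₂ v| := by
  have hw0 : 0 ≤ (1 - s) ^ 2 := sq_nonneg _
  have hw1 : 0 ≤ 2 * s * (1 - s) := by have := sub_nonneg.mpr hs1; positivity
  have hw2 : 0 ≤ s ^ 2 := sq_nonneg _
  -- the priced sum is at most the Bernstein combination of the three priced sums
  have hsum : ∑ v ∈ Vs, ρ v * |r₀ v + s * r₁ v + s ^ 2 * r₂ v| ≤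
      ∑ v ∈ Vs, ρ v * ((1 - s) ^ 2 * |r₀ v| + 2 * s * (1 - s) * |r₀ v + r₁ v / 2|
        + s ^ 2 * |r₀ v + r₁ v + r₂ v|) :=
    Finset.sum_le_sum fun v hv =>
      mul_le_mul_of_nonneg_left (abs_quadratic_le_bernstein (r₀ v) (r₁ v) (r₂ v) hs0 hs1) (hρ v hv)
  have hsplit : ∑ v ∈ Vs, ρ v * ((1 - s) ^ 2 * |r₀ v| + 2 * s * (1 - s) * |r₀ v + r₁ v / 2|
        + s ^ 2 * |r₀ v + r₁ v + r₂ v|) =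
      (1 - s) ^ 2 * ∑ v ∈ Vs, ρ v * |r₀ v| + 2 * s * (1 - s) * ∑ v ∈ Vs, ρ v * |r₀ v + r₁ v / 2|
        + s ^ 2 * ∑ v ∈ Vs, ρ v * |r₀ v + r₁ v + r₂ v| := by
    simp only [Finset.mul_sum, ← Finset.sum_add_distrib]
    refine Finset.sum_congr rfl fun v _ => by ring
  have hβ : β₀ + s * β₁ + s ^ 2 * β₂ =
      (1 - s) ^ 2 * β₀ + 2 * s * (1 - s) * (β₀ + β₁ / 2) + s ^ 2 * (β₀ + β₁ + β₂) :=
    quadratic_eq_bernstein β₀ β₁ β₂ s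
  -- hence E(s) ≥ the Bernstein combination of E(0), E_C, E(1) ...
  have hE : (1 - s) ^ 2 * (β₀ - ∑ v ∈ Vs, ρ v * |r₀ v|)
        + 2 * s * (1 - s) * ((β₀ + β₁ / 2) - ∑ v ∈ Vs, ρ v * |r₀ v + r₁ v / 2|)
        + s ^ 2 * ((β₀ + β₁ + β₂) - ∑ v ∈ Vs, ρ v * |r₀ v + r₁ v + r₂ v|) ≤
      (β₀ + s * β₁ + s ^ 2 * β₂) - ∑ v ∈ Vs, ρ v * |r₀ v + s * r₁ v + s ^ 2 * r₂ v| := by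
    rw [hβ]; linarith
  -- ... which is at least their minimum (nonnegative weights summing to one)
  set E0 := β₀ - ∑ v ∈ Vs, ρ v * |r₀ v|
  set EC := (β₀ + β₁ / 2) - ∑ v ∈ Vs, ρ v * |r₀ v + r₁ v / 2|
  set E1 := (β₀ + β₁ + β₂) - ∑ v ∈ Vs, ρ v * |r₀ v + r₁ v + r₂ v|
  set m := min (min E0 EC) E1
  have hm0 : m ≤ E0 := (min_le_left _ _).trans (min_le_left _ _)
  have hm1 : m ≤ EC := (min_le_left _ _).trans (min_le_right _ _)
  have hm2 : m ≤ E1 := min_le_right _ _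
  have hone : (1 - s) ^ 2 * m + 2 * s * (1 - s) * m + s ^ 2 * m = m := by ring
  nlinarith [mul_le_mul_of_nonneg_left hm0 hw0, mul_le_mul_of_nonneg_left hm1 hw1,
    mul_le_mul_of_nonneg_left hm2 hw2]

end Floors

end Literature.Computation.Certificates.PencilSegment
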